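import Mathlib.MeasureTheory.Integral.IntervalIntegral.Basic
import Mathlib.Analysis.Calculus.IteratedDeriv.Lemmas
import HarnessLib

/-!
# The full-gap MODE FORM of the affine background method for Rayleigh–Bénard convection and the
# named hypothesis `SpectralReduction` = the CITED reduction theorem, transcribed mode-wise (horizontal-Fourier form)
(cell `pub-turb` / `turb-bounds`, v2 lane of the Ra-uniform ladder P2; files of record HOME/pub-turb-sos/P2-PROOF.md §2.1–2.2
(= paper §2 and Appendix A.1–A.2), HOME/pub-turb-sos/FORMULATION-SPEC.md §A–§B, refereed transcription checks R-A / R-B PASS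
(HOME/tribunal/t-lemmas.md pass 1). Written by pub-turb-sos, planner-pub-turb-sos-g10-0.)

HONEST FRAMING: rigorous bounds for the stated PDE and boundary conditions; no claim about physical turbulence beyond the bound.

PURPOSE. The v1 row theorems `Results.<Row>.nusselt_bound` consume the named hypothesis `LayerForm.LayerReduction Nu`, whose content is a
published theorem (the affine background-method reduction [cite: DingKerswell2019, (13)–(16)], in the horizontal-Fourier-mode form of
[cite: DoeringConstantin1996, Sec. III]) COMBINED WITH two lemmas of this cell (bulk drop R-P2a, Ra-free rescaling R-P2b; refereed prose,
P2-PROOF 2.4–2.5 = Appendix A.7 (a)(b)). This file types the published theorem ALONE, over the full gap `0 ≤ z ≤ 1` with the two-sided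
(no-slip, isothermal) test class, as `SpectralReduction Nu`; the companion file `P2Profile.lean` PROVES `SpectralReduction Nu → LayerReduction Nu`,
i.e. it kernel-checks R-P2a and R-P2b for the P2 profile family. After it, every cell-made step of the P2 rows is kernel-checked and the one
remaining named hypothesis is a TRANSCRIPTION of a published statement with nothing cell-made inside it ('transcribed', not 'verbatim' — lead decision
100 (C): the display (13)–(16) of [cite: DingKerswell2019] is PDE-level for 2-D stress-free plates and [cite: DoeringGibbon1995, §10.3
(10.3.26)–(10.3.33)] is no-slip without balance parameter; the mode-wise form over the no-slip class with balance parameter `s` is this cell's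
refereed transcription, checks R-A / R-B).

CONTENTS (real analysis over Mathlib only; NO Navier–Stokes / Boussinesq theory is formalised here):
* `modeIntegrand`, `modeForm` — P2-PROOF 2.2 verbatim: for a horizontal wavenumber `k > 0`,
  `Q_k[w, θ] = ∫₀¹ A₀ (w″²/k² + 2 w′² + k² w²) + s (θ′² + k² θ²) + 2 (s τ′) w θ dz`, `A₀ = (s − 1)/Ra`, as an interval integral of total
  functions `w θ : ℝ → ℝ` (`deriv` = Mathlib's derivative; on the class below the integrand is a genuine integrable function);
* `TwoSided w θ` — the two-sided test class: `w ∈ C²(ℝ)`, `θ ∈ C¹(ℝ)`, `w = w′ = 0` and `θ = 0` at `z = 0` and at `z = 1`;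
* `SpectralConstraint Ra s τ′` — statement (A1) of P2-PROOF 2.1 in mode form: `Q_k ≥ 0` for every `k > 0` on the two-sided class;
* `Profile τ′` — the admissible background data: `τ′ ∈ L¹ ∩ L²(0, 1)` (as interval integrability of `τ′` and `τ′²`) with `∫₀¹ τ′ = −1`,
  i.e. exactly `τ(z) := 1 + ∫₀ᶻ τ′ ∈ H¹(0, 1)` with `τ(0) = 1`, `τ(1) = 0` (the profile class of the cited theorem);
* `SpectralReduction Nu` — the NAMED HYPOTHESIS (harness model: a published theorem USED, never proved here; docstring = transcription + sources);
* `intervalIntegrable_modeIntegrand` — on the class, for `τ′ ∈ L¹`, the mode integrand is integrable on every `[a, b]`;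
* guards: `twoSided_zero` (the class is inhabited), `sq_integral_ge_one` (`∫₀¹ τ′² ≥ 1` for every admissible profile, so every instance of the
  bound is `≥ 1`), `spectralReduction_conduction` (`SpectralReduction (fun _ => 1)`: the hypothesis is satisfiable as typed; that it is not provable
  for every `Nu` is `Results.P2Spectral.spectralReduction_nontrivial`, from the certificate), and `integral_modeIntegrand_nonneg_of_eqOn_zero`
  (where `τ′ ≡ 0` the mode form of a sub-interval is `≥ 0` — the bulk-drop inequality R-P2a in its pointwise form).
-/

set_option linter.style.longLine false

noncomputable section

namespace Summit.NavierStokesRegularity.TurbBounds.SpectralForm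

open MeasureTheory intervalIntegral Set

/-! ## 1. The mode form on the full gap (P2-PROOF 2.2 = FORMULATION-SPEC (B) = paper §2 / Appendix A.2) -/

/-- Integrand of the mode form `Q_k` at height `z` (P2-PROOF 2.2, verbatim):
`A₀ (w″²/k² + 2 w′² + k² w²) + s (θ′² + k² θ²) + 2 s τ′ w θ` with `A₀ = (s − 1)/Ra` and coupling `g = s τ′`. -/
def modeIntegrand (Ra s : ℝ) (τp : ℝ → ℝ) (k : ℝ) (w θ : ℝ → ℝ) (z : ℝ) : ℝ :=
  (s - 1) / Ra * ((deriv (deriv w) z) ^ 2 / k ^ 2 + 2 * (deriv w z) ^ 2 + k ^ 2 * (w z) ^ 2)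
    + s * ((deriv θ z) ^ 2 + k ^ 2 * (θ z) ^ 2) + 2 * s * τp z * w z * θ z

/-- The mode form `Q_k[w, θ] = ∫₀¹ modeIntegrand dz` (interval integral w.r.t. Lebesgue measure on the gap `0 ≤ z ≤ 1`). -/
def modeForm (Ra s : ℝ) (τp : ℝ → ℝ) (k : ℝ) (w θ : ℝ → ℝ) : ℝ :=
  ∫ z in (0 : ℝ)..1, modeIntegrand Ra s τp k w θ z

/-- The two-sided test class of the gap (no-slip isothermal plates at `z = 0` and `z = 1`): `w ∈ C²(ℝ)`, `θ ∈ C¹(ℝ)`,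
`w(0) = w′(0) = w(1) = w′(1) = 0`, `θ(0) = θ(1) = 0`. (The cited theorem is stated on `(H² ∩ H¹₀) × H¹₀` of `(0, 1)` with `w′ = 0` at the
walls; the restrictions of these functions are dense there and `Q_k` is continuous in that topology — the same density remark as in
`LayerForm.LayerReduction`'s transcription.) -/
structure TwoSided (w θ : ℝ → ℝ) : Prop where
  /-- `w` is twice continuously differentiable. -/
  hw : ContDiff ℝ 2 w
  /-- `θ` is continuously differentiable. -/
  hθ : ContDiff ℝ 1 θ
  /-- no-slip bottom plate: `w(0) = 0`. -/
  w_bot : w 0 = 0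
  /-- no-slip bottom plate: `w′(0) = 0`. -/
  dw_bot : deriv w 0 = 0
  /-- no-slip top plate: `w(1) = 0`. -/
  w_top : w 1 = 0
  /-- no-slip top plate: `w′(1) = 0`. -/
  dw_top : deriv w 1 = 0
  /-- isothermal bottom plate: `θ(0) = 0`. -/
  θ_bot : θ 0 = 0
  /-- isothermal top plate: `θ(1) = 0`. -/
  θ_top : θ 1 = 0

/-- Statement (A1) of P2-PROOF 2.1 in mode form (2.2): the spectral constraint of the affine background method at Rayleigh number `Ra`,
balance parameter `s` and profile derivative `τ′` — `Q_k[w, θ] ≥ 0` for every horizontal wavenumber `k > 0` and every two-sided pair. -/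
def SpectralConstraint (Ra s : ℝ) (τp : ℝ → ℝ) : Prop :=
  ∀ k : ℝ, 0 < k → ∀ w θ : ℝ → ℝ, TwoSided w θ → 0 ≤ modeForm Ra s τp k w θ

/-- Admissible background data (the profile class of the cited theorem): `τ′` and `τ′²` interval-integrable on `[0, 1]` (so
`τ′ ∈ L¹ ∩ L²(0, 1)`) and `∫₀¹ τ′ = −1`; equivalently `τ(z) := 1 + ∫₀ᶻ τ′` lies in `H¹(0, 1)` with `τ(0) = 1`, `τ(1) = 0`. -/
structure Profile (τp : ℝ → ℝ) : Prop where
  /-- `τ′ ∈ L¹(0, 1)`. -/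
  integrable : IntervalIntegrable τp volume 0 1
  /-- `τ′ ∈ L²(0, 1)`. -/
  sq_integrable : IntervalIntegrable (fun z => τp z ^ 2) volume 0 1
  /-- `τ(1) − τ(0) = ∫₀¹ τ′ = −1`. -/
  total : (∫ z in (0 : ℝ)..1, τp z) = -1

/-! ## 2. The named hypothesis = the cited reduction theorem (USED as a hypothesis, never proved in this cell) -/

/-- **Named hypothesis `SpectralReduction Nu`** (harness model). TRANSCRIPTION, for the referee's line-by-line check: for every Rayleigh
number `Ra > 0`, every balance parameter `s > 1` and every admissible profile derivative `τ′` (`Profile τ′`), IF the spectral constraint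
(A1) holds in mode form — `SpectralConstraint Ra s τ′`: `Q_k[w, θ] ≥ 0` for all `k > 0` and all two-sided `(w, θ)` — THEN
`Nu(Ra) ≤ 1 + (1/s)∫₀¹ φ² = s ∫₀¹ τ′² − (s − 1)` (P2-PROOF (A2), `φ = s(τ′ + 1)`, `∫₀¹ φ = 0`).
CONTENT = exactly the published affine background-method reduction '(A1) ⇒ (A2)' [cite: DingKerswell2019, (13)–(16)] (equivalently
[cite: DoeringConstantin1996, Sec. III]; the variational principle without balance parameter is [cite: DoeringGibbon1995, §10.3
(10.3.26)–(10.3.33)]) together with the classical horizontal Fourier / poloidal–toroidal decomposition that turns (A1) into the mode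
forms `Q_k` for `k > 0` (P2-PROOF 2.2 = FORMULATION-SPEC (B2); `k = 0` carries no constraint, the toroidal part is a non-negative extra term;
refereed transcription checks R-A, R-B PASS, HOME/tribunal/t-lemmas.md pass 1), and the density remark in `TwoSided`'s docstring.
Unlike `LayerForm.LayerReduction`, NOTHING of this cell's own making is inside this hypothesis: the bulk drop R-P2a and the rescaling R-P2b
are THEOREMS of `P2Profile.lean` (`layerReduction_of_spectralReduction`).
MEANING OF `Nu`: as in `LayerForm.LayerReduction` — any function `Nu : ℝ → ℝ` such that `Nu Ra` is the Nusselt number `1 + ⟨wT⟩` of some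
admissible (Leray–Hopf, Galerkin-limit) solution of the Boussinesq system between no-slip isothermal plates at Rayleigh number `Ra`, with
arbitrary Prandtl number `Pr ∈ (0, ∞]`, horizontal period(s) and `d ∈ {2, 3}` (P2-PROOF §1); the cited theorem bounds every such value, so a
row theorem `∀ Nu, SpectralReduction Nu → … → Nu Ra ≤ …` is the bound for all solutions.
VACUITY: satisfiable as typed (`spectralReduction_conduction`); not provable for every `Nu` (`Results.P2Spectral.spectralReduction_nontrivial`,
from the kernel-checked P2-R0 certificate chain); its premise `SpectralConstraint` is MET by the P2 profiles
(`Results.P2Spectral.P2R0.spectralConstraint_holds`, unconditional). -/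
def SpectralReduction (Nu : ℝ → ℝ) : Prop :=
  ∀ (Ra s : ℝ) (τp : ℝ → ℝ), 0 < Ra → 1 < s → Profile τp → SpectralConstraint Ra s τp →
    Nu Ra ≤ s * (∫ z in (0 : ℝ)..1, τp z ^ 2) - (s - 1)

/-! ## 3. Elementary facts and vacuity guards -/

/-- The two-sided class is inhabited (by the zero pair), so `SpectralConstraint` quantifies over a nonempty class. -/
theorem twoSided_zero : TwoSided (fun _ => 0) (fun _ => 0) where
  hw := contDiff_const
  hθ := contDiff_const
  w_bot := rfl
  dw_bot := by simp
  w_top := rfl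
  dw_top := by simp
  θ_bot := rfl
  θ_top := rfl

/-- Pointwise bulk inequality (R-P2a in pointwise form): where the profile is flat (`τ′(z) = 0`) the mode integrand is a sum of squares with
nonnegative weights, hence `≥ 0` for ALL `w, θ` (no regularity or boundary condition needed), provided `1 ≤ s` and `0 ≤ Ra`
(for `Ra = 0` Mathlib's `x / 0 = 0` makes the first weight `0`). -/
theorem modeIntegrand_nonneg_of_tau_zero {Ra s k : ℝ} {τp w θ : ℝ → ℝ} (hs : 1 ≤ s) (hRa : 0 ≤ Ra) {z : ℝ}
    (hz : τp z = 0) : 0 ≤ modeIntegrand Ra s τp k w θ z := by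
  unfold modeIntegrand
  rw [hz]
  have hA : 0 ≤ (s - 1) / Ra := div_nonneg (sub_nonneg.mpr hs) hRa
  have h1 : 0 ≤ (s - 1) / Ra * ((deriv (deriv w) z) ^ 2 / k ^ 2 + 2 * (deriv w z) ^ 2 + k ^ 2 * (w z) ^ 2) :=
    mul_nonneg hA (by positivity)
  have h2 : 0 ≤ s * ((deriv θ z) ^ 2 + k ^ 2 * (θ z) ^ 2) := mul_nonneg (le_trans zero_le_one hs) (by positivity)
  have h3 : 2 * s * (0 : ℝ) * w z * θ z = 0 := by ring
  rw [h3]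
  linarith

/-- Bulk-drop inequality R-P2a on a sub-interval: if `τ′ = 0` on the open interval `(a, b)` (`a ≤ b`), then `∫ₐᵇ modeIntegrand ≥ 0` for
ALL `w, θ` (the integrand agrees on `(a, b)` with a pointwise nonnegative function; endpoints are Lebesgue-null; no integrability needed —
a non-integrable integrand has interval integral `0`). -/
theorem integral_modeIntegrand_nonneg_of_eqOn_zero {Ra s k a b : ℝ} {τp w θ : ℝ → ℝ} (hs : 1 ≤ s) (hRa : 0 ≤ Ra)
    (hab : a ≤ b) (hz : ∀ z ∈ Ioo a b, τp z = 0) :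
    0 ≤ ∫ z in a..b, modeIntegrand Ra s τp k w θ z := by
  rw [integral_congr_Ioo_of_le hab (g := modeIntegrand Ra s (fun _ => 0) k w θ) (fun z hzm => by
    unfold modeIntegrand; rw [hz z hzm])]
  exact integral_nonneg_of_forall hab fun z => modeIntegrand_nonneg_of_tau_zero hs hRa rfl

/-- On the two-sided regularity class (`w ∈ C²(ℝ)`, `θ ∈ C¹(ℝ)`) and for `τ′ ∈ L¹(a, b)` the mode integrand is interval-integrable on
`[a, b]`: the derivative terms are continuous, the coupling term is `L¹ · C⁰ · C⁰`. (Used to split `∫₀¹` into the two layers and the bulk.) -/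
theorem intervalIntegrable_modeIntegrand {Ra s k a b : ℝ} {τp w θ : ℝ → ℝ} (hτ : IntervalIntegrable τp volume a b)
    (hw : ContDiff ℝ 2 w) (hθ : ContDiff ℝ 1 θ) : IntervalIntegrable (modeIntegrand Ra s τp k w θ) volume a b := by
  have hw0 : Continuous w := hw.continuous
  have hw1 : Continuous (deriv w) := hw.continuous_deriv (by norm_num)
  have hw2 : Continuous (deriv (deriv w)) := by
    have h := hw.continuous_iteratedDeriv 2 (by norm_num)
    rwa [iteratedDeriv_succ, iteratedDeriv_one] at h
  have hθ0 : Continuous θ := hθ.continuous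
  have hθ1 : Continuous (deriv θ) := hθ.continuous_deriv (by norm_num)
  have hΦ : Continuous fun z => (s - 1) / Ra * ((deriv (deriv w) z) ^ 2 / k ^ 2 + 2 * (deriv w z) ^ 2 + k ^ 2 * (w z) ^ 2)
      + s * ((deriv θ z) ^ 2 + k ^ 2 * (θ z) ^ 2) :=
    (continuous_const.mul ((((hw2.pow 2).div_const _).add (continuous_const.mul (hw1.pow 2))).add
      (continuous_const.mul (hw0.pow 2)))).add
      (continuous_const.mul ((hθ1.pow 2).add (continuous_const.mul (hθ0.pow 2))))
  have hC : IntervalIntegrable (fun z => 2 * s * τp z * w z * θ z) volume a b :=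
    ((hτ.const_mul (2 * s)).mul_continuousOn hw0.continuousOn).mul_continuousOn hθ0.continuousOn
  exact (hΦ.intervalIntegrable a b).add hC

/-- For an admissible profile, `∫₀¹ τ′² ≥ 1` (from `∫₀¹ (τ′ + 1)² ≥ 0` and `∫₀¹ τ′ = −1`; Cauchy–Schwarz in disguise). Hence every
instance `s ∫₀¹ τ′² − (s − 1)` of the bound is `≥ 1`, consistent with `Nu ≥ 1`. -/
theorem sq_integral_ge_one {τp : ℝ → ℝ} (h : Profile τp) : 1 ≤ ∫ z in (0 : ℝ)..1, τp z ^ 2 := by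
  have hlin : IntervalIntegrable (fun z => 2 * τp z + 1) volume 0 1 :=
    (h.integrable.const_mul 2).add intervalIntegrable_const
  have hsum : IntervalIntegrable (fun z => τp z ^ 2 + (2 * τp z + 1)) volume 0 1 := h.sq_integrable.add hlin
  have hnn : 0 ≤ ∫ z in (0 : ℝ)..1, (τp z ^ 2 + (2 * τp z + 1)) :=
    integral_nonneg_of_forall zero_le_one fun z => by nlinarith [sq_nonneg (τp z + 1)]
  have hsplit : (∫ z in (0 : ℝ)..1, (τp z ^ 2 + (2 * τp z + 1)))
      = (∫ z in (0 : ℝ)..1, τp z ^ 2) + (2 * (∫ z in (0 : ℝ)..1, τp z) + 1) := by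
    rw [integral_add h.sq_integrable hlin, integral_add (h.integrable.const_mul 2) intervalIntegrable_const,
      intervalIntegral.integral_const_mul, intervalIntegral.integral_const]
    simp
  rw [hsplit, h.total] at hnn
  linarith

/-- **Vacuity guard: `SpectralReduction` is satisfiable as typed.** The conduction value `Nu ≡ 1` obeys it, because every instance of the
bound is `s ∫₀¹ τ′² − (s − 1) ≥ s − (s − 1) = 1` (`sq_integral_ge_one`). -/
theorem spectralReduction_conduction : SpectralReduction (fun _ => 1) := by
  intro Ra s τp _ hs hprof _
  have h1 : 1 ≤ ∫ z in (0 : ℝ)..1, τp z ^ 2 := sq_integral_ge_one hprof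
  have hs0 : 0 ≤ s := by linarith
  nlinarith [mul_le_mul_of_nonneg_left h1 hs0]

end Summit.NavierStokesRegularity.TurbBounds.SpectralForm

end
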